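import Literature.Topology.FourManifolds.TorusKnotMilnorFibreHomology
import Literature.AlgebraicTopology.SingularHomology.BoundaryComplementHomology
import Literature.Topology.FourManifolds.RasmussenTorusKnotProofs
import Literature.Topology.FourManifolds.RasmussenProofs
import Literature.Topology.FourManifolds.RasmussenSliceGenusProofs
import HarnessLib

/-!
# The Milnor fibre is a Seifert surface of genus `(p-1)(q-1)/2` for `T(p,q)`: `g₄(T(p,q)) ≤ (p-1)(q-1)/2`

Topic `Literature/Topology/FourManifolds`; fact seat
`provefact-Literature.Topology.FourManifolds.sliceGenus_torusKnot` (the Milnor conjecture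
`g₄(T(p,q)) = (p-1)(q-1)/2`, `Rasmussen.lean`), fifth and final file of the **upper bound**.
Everything here is **proved**; no named fact is introduced (D-0026).

Assembly of the sibling files:

* `TorusKnotMilnorFibre.lean` — the closed Milnor fibre `Σ̄` of `U^q - V^p` is a compact oriented
  `C^∞` surface with boundary `T(p,q)`, and a Seifert surface of genus `g` of the tree's
  `torusKnot p q` as soon as it is connected with `rank H₁(Σ̄; ℤ) = 2g`
  (`TorusKnotMilnor.hasSeifertSurfaceOfGenus_of_finrank`);
* `TorusKnotMilnorFibreAffine.lean` — its interior is homeomorphic to the affine fibre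
  `{U^q - V^p = 1}` (Milnor 1968, Lemma 9.4; `TorusKnotMilnor.intHomeoAff`);
* `TorusKnotMilnorFibreHomology.lean` — the affine fibre is path connected with
  `rank H₁ = (p-1)(q-1)` (Milnor 1968, Thm. 9.1; `finrank_singularHomology_one_affFibre`);
* `BoundaryComplementHomology.lean` — the interior of a compact `∂`-manifold carries all of its
  homology (`isIso_singularHomology_map_interior_of_compactSpace`).

Here: the interior of a `C¹` manifold with boundary is dense
(`boundary_subset_closure_compl_boundary`, from the tree's half charts), so `Σ̄` is connected
(`TorusKnotMilnor.connectedSpace_fibre`); `rank H₁(Σ̄; ℤ) = (p-1)(q-1)`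
(`TorusKnotMilnor.finrank_singularHomology_one_fibre`), which is even for coprime `p, q`; hence
(Milnor 1968, §10 (5)–(6): *"the fiber `F` is an orientable surface of genus `μ/2`"*, and
Kronheimer–Mrowka 1993, p. 775: *"the Milnor fibre … has genus `½(p-1)(q-1)`"*)

* **`hasSeifertSurfaceOfGenus_torusKnot`**: `T(p,q)` bounds a Seifert surface of genus
  `(p-1)(q-1)/2`, so `g(T(p,q)) ≤ (p-1)(q-1)/2` and **`g₄(T(p,q)) ≤ (p-1)(q-1)/2`**
  (`genus_torusKnot_le`, `sliceGenus_torusKnot_le`), unconditionally;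
* **`sliceGenus_torusKnot_of_rasmussen`**: the named fact `sliceGenus_torusKnot` (the Milnor
  conjecture) follows from Rasmussen's bound `abs_le_two_mul_sliceGenus` (2010, Thm. 1) and the
  value `hasRasmussenInvariant_torusKnot` (2010, Thm. 4), via the assembly step
  `sliceGenus_torusKnot_of_hasSeifertSurfaceOfGenus` (`RasmussenTorusKnotProofs.lean`); since
  the latter is discharged in the tree (`hasRasmussenInvariant_torusKnot_holds`,
  `RasmussenProofs.lean`), **`sliceGenus_torusKnot_of_abs_le_two_mul_sliceGenus`** reduces the
  Milnor conjecture to the single undischarged named fact `abs_le_two_mul_sliceGenus`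
  (Rasmussen's Theorem 1, the maps on Lee homology induced by cobordisms);
* **only the upper half of Theorem 1 is needed**: since `s(T(p,q)) = (p-1)(q-1) ≥ 0`, the Milnor
  conjecture follows from the one-sided bound `s(K) ≤ 2 g₄(K)` alone
  (`sliceGenus_torusKnot_of_le_two_mul_sliceGenus`), i.e. from its diagrammatic form
  (`sliceGenus_torusKnot_of_diagram`) or from the class-injective filtered maps `φ_S : K → U` of
  degree `-2g` on degree-zero Lee cycles which Rasmussen's §4 attaches to a genus-`g` cobordism
  to the unknot (`sliceGenus_torusKnot_of_filtered`, through `le_two_mul_sliceGenus_of_filtered`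
  of `RasmussenSliceGenusProofs.lean`) — with no appeal to the mirror formula `s(K̄) = -s(K)` or
  to maps in the direction `U → K`; invariant-free, it is the statement that no slice surface of
  `T(p,q)` has genus `< (p-1)(q-1)/2` (`sliceGenus_torusKnot_of_lowerBound`, the form in which
  Kronheimer–Mrowka's adjunction inequality delivers it, 1993, Cor. 1.3).

## References

* J. Milnor, *Singular points of complex hypersurfaces*, Ann. of Math. Studies 61 (1968), §9
  Thm. 9.1, Lemma 9.4; §10 (PDF p. 46). [Milnor1968]
* P. Kronheimer, T. Mrowka, *Gauge theory for embedded surfaces I*, Topology 32 (1993), Cor. 1.3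
  and p. 775. [KronheimerMrowka1993]
* J. Rasmussen, *Khovanov homology and the slice genus*, Invent. Math. 182 (2010), Thm. 1, Thm. 4,
  §1 Cor. 1. [Rasmussen2010]
* A. Hatcher, *Algebraic Topology* (2002), Prop. 3.42. [HatcherAT2002]
-/

open scoped Manifold ContDiff Topology
open Function Set Filter Metric
open Literature.AlgebraicTopology.SingularHomology CategoryTheory Limits

noncomputable section

universe u

namespace Literature.Topology.FourManifolds

/-! ### The interior of a `C¹` manifold with boundary is dense -/

section Density

variable {n : ℕ} {X : Type u} [TopologicalSpace X] [ChartedSpace (EuclideanHalfSpace (n + 1)) X]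
  {m : WithTop ℕ∞} [IsManifold (𝓡∂ (n + 1)) m X]

/-- **Boundary points are limits of interior points**: in a half chart `e` at `p ∈ ∂X` (the tree's
`HalfChart`, `BoundaryTransfer.lean`) the points `e⁻¹(t, 0)`, `t → 0⁺`, are interior points
converging to `p`. [folklore] -/
theorem boundary_subset_closure_compl_boundary (hm : m ≠ 0) :
    (𝓡∂ (n + 1)).boundary X ⊆ closure (((𝓡∂ (n + 1)).boundary X)ᶜ) := by
  intro p hp
  obtain ⟨h, ⟨c⟩⟩ := SmoothHalfChart.exists_halfChart n hm hp
  have hpos := c.pos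
  -- the segment `(t, 0)`, `0 ≤ t ≤ 4h`, lies in the chart target
  have htarget : ∀ t : ℝ, 0 ≤ t → t ≤ 4 * h →
      ((t, (0 : EuclideanSpace ℝ (Fin n))) : ℝ × EuclideanSpace ℝ (Fin n)) ∈ c.e.target := fun t h0 h1 =>
    c.subset_target ⟨h0, by
      rw [mem_closedBall, dist_zero_right, Prod.norm_def, norm_zero, Real.norm_eq_abs, abs_of_nonneg h0,
        max_eq_left h0]
      exact h1⟩
  have h0t : ((0 : ℝ), (0 : EuclideanSpace ℝ (Fin n))) ∈ c.e.target := htarget 0 le_rfl (by positivity)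
  have hsymm0 : c.e.symm ((0 : ℝ), (0 : EuclideanSpace ℝ (Fin n))) = p := by
    rw [show ((0 : ℝ), (0 : EuclideanSpace ℝ (Fin n))) = c.e p from c.apply_eq_zero.symm]
    exact c.e.left_inv c.mem_source
  have hIoo : Ioo (0 : ℝ) (4 * h) ∈ 𝓝[>] (0 : ℝ) := Ioo_mem_nhdsGT (by positivity)
  apply mem_closure_of_tendsto (f := fun t : ℝ => c.e.symm (t, 0)) (b := 𝓝[>] (0 : ℝ))
  · have hcw : ContinuousWithinAt c.e.symm c.e.target ((0 : ℝ), 0) := c.continuousOn_symm _ h0t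
    have h1 : Tendsto (fun t : ℝ => ((t, (0 : EuclideanSpace ℝ (Fin n))) : ℝ × EuclideanSpace ℝ (Fin n)))
        (𝓝[>] 0) (𝓝[c.e.target] ((0 : ℝ), 0)) := by
      rw [tendsto_nhdsWithin_iff]
      refine ⟨((continuous_id.prodMk continuous_const).tendsto 0).mono_left nhdsWithin_le_nhds, ?_⟩
      filter_upwards [hIoo] with t ht
      exact htarget t ht.1.le ht.2.le
    have := hcw.tendsto.comp h1
    rwa [hsymm0] at this
  · filter_upwards [hIoo] with t ht
    intro hB
    have hvt := htarget t ht.1.le ht.2.le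
    have hsrc : c.e.symm (t, 0) ∈ c.e.source := c.e.map_target hvt
    have key := (c.mem_iff _ hsrc (by
      rw [c.e.right_inv hvt, mem_closedBall, dist_zero_right, Prod.norm_def, norm_zero, Real.norm_eq_abs,
        abs_of_nonneg ht.1.le, max_eq_left ht.1.le]
      exact ht.2.le)).1 hB
    rw [c.e.right_inv hvt] at key
    exact ht.1.ne' key

/-- **The interior of a `C¹` manifold with boundary is dense.** [folklore] -/
theorem dense_compl_boundary (hm : m ≠ 0) : Dense (((𝓡∂ (n + 1)).boundary X)ᶜ) := fun x => by
  by_cases hx : x ∈ (𝓡∂ (n + 1)).boundary X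
  · exact boundary_subset_closure_compl_boundary hm hx
  · exact subset_closure hx

/-- A manifold with boundary whose interior is preconnected and nonempty is connected. [folklore] -/
theorem connectedSpace_of_isPreconnected_compl_boundary (hm : m ≠ 0)
    (h : IsPreconnected ((((𝓡∂ (n + 1)).boundary X)ᶜ : Set X))) (hne : ((((𝓡∂ (n + 1)).boundary X)ᶜ : Set X)).Nonempty) :
    ConnectedSpace X := by
  rw [connectedSpace_iff_univ, ← (dense_compl_boundary (n := n) (X := X) hm).closure_eq]
  exact ⟨hne.mono subset_closure, h.closure⟩

end Density

/-! ### The closed Milnor fibre: connected, `rank H₁ = (p-1)(q-1)` -/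

namespace TorusKnotMilnor

variable {p q : ℕ} (hp : p ≠ 0) (hq : q ≠ 0)

/-- The interior of the closed Milnor fibre is path connected (homeomorphic to the path-connected
affine fibre). [cite: Milnor1968, §9 Lemma 9.4] -/
theorem isPathConnected_compl_boundary_fibre :
    IsPathConnected ((((𝓡∂ 2).boundary (Fibre hp hq))ᶜ : Set (Fibre hp hq))) := by
  haveI := pathConnectedSpace_affFibre hp hq
  rw [isPathConnected_iff_pathConnectedSpace]
  rw [pathConnectedSpace_iff_univ]
  have h := (isPathConnected_univ (X := ↥(affFibre p q))).image (f := (intHomeoAff hp hq).symm)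
    (intHomeoAff hp hq).symm.continuous
  rwa [image_univ, (intHomeoAff hp hq).symm.surjective.range_eq] at h

/-- **The closed Milnor fibre `Σ̄` is connected.** [cite: Milnor1968, §10 (PDF p. 46)] -/
theorem connectedSpace_fibre : ConnectedSpace (Fibre hp hq) :=
  connectedSpace_of_isPreconnected_compl_boundary (n := 1) (m := ∞) (by simp)
    (isPathConnected_compl_boundary_fibre hp hq).isConnected.isPreconnected
    (isPathConnected_compl_boundary_fibre hp hq).nonempty

/-- **`H₁(Σ̄; ℤ) ≃ H₁(F'; ℤ)`**: through the interior (`isIso_singularHomology_map_interior`,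
homological collar theorem) and Milnor's Lemma 9.4 (`intHomeoAff`).
[cite: Milnor1968, §9 Lemma 9.4] -/
def singularHomologyOneFibreEquiv :
    singularHomology ℤ ℤ (Fibre hp hq) 1 ≃ₗ[ℤ] singularHomology ℤ ℤ ↥(affFibre p q) 1 :=
  haveI := isIso_singularHomology_map_interior_of_compactSpace ℤ ℤ (X := Fibre hp hq) (n := 1) (m := ∞)
    (by simp) 1
  (asIso (singularHomology.map ℤ ℤ (subsetIncl ((((𝓡∂ (1 + 1)).boundary (Fibre hp hq))ᶜ : Set (Fibre hp hq)))) 1)).symm.toLinearEquiv ≪≫ₗ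
    (singularHomology.mapIso ℤ ℤ (intHomeoAff hp hq) 1).toLinearEquiv

/-- **`rank_ℤ H₁(Σ̄; ℤ) = (p-1)(q-1)`** for the closed Milnor fibre of `T(p,q)` (Milnor 1968,
Thm. 9.1 with Lemma 9.4). [cite: Milnor1968, §9 Thm. 9.1 (PDF p. 39)] -/
theorem finrank_singularHomology_one_fibre :
    Module.finrank ℤ (singularHomology ℤ ℤ (Fibre hp hq) 1) = (p - 1) * (q - 1) := by
  rw [LinearEquiv.finrank_eq (singularHomologyOneFibreEquiv hp hq)]
  exact (finrank_singularHomology_one_affFibre hp hq).1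

end TorusKnotMilnor

/-! ### The upper bound for the slice genus of the torus knot -/

section TorusKnot

variable {p q : ℕ}

/-- For coprime `p, q` the number `(p-1)(q-1)` is even (`p`, `q` are not both even). [folklore] -/
theorem even_pred_mul_pred_of_coprime (h : p.Coprime q) : Even ((p - 1) * (q - 1)) := by
  rcases Nat.even_or_odd p with hp | hp
  · rcases Nat.even_or_odd q with hq' | hq'
    · exfalso
      have h2 : 2 ∣ Nat.gcd p q := Nat.dvd_gcd (even_iff_two_dvd.1 hp) (even_iff_two_dvd.1 hq')
      rw [Nat.Coprime.gcd_eq_one h] at h2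
      omega
    · exact (Nat.Odd.sub_odd hq' odd_one).mul_left _
  · exact (Nat.Odd.sub_odd hp odd_one).mul_right _

/-- **The torus knot `T(p,q)` bounds a Seifert surface of genus `(p-1)(q-1)/2`** — the closed
Milnor fibre of `U^q = V^p` in `𝕊³` (Milnor 1968, §10 (5)–(6); Kronheimer–Mrowka 1993, p. 775),
in the sense of `Knot.HasSeifertSurfaceOfGenus` (`SliceGenus.lean`) for the tree's
`torusKnot p q`. [cite: Milnor1968, §10 (PDF p. 46)] -/
theorem hasSeifertSurfaceOfGenus_torusKnot (hp : 2 ≤ p) (hq : 2 ≤ q) (h : p.Coprime q) :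
    (torusKnot p q hp hq h).HasSeifertSurfaceOfGenus ((p - 1) * (q - 1) / 2) :=
  TorusKnotMilnor.hasSeifertSurfaceOfGenus_of_finrank hp hq h
    (TorusKnotMilnor.connectedSpace_fibre _ _)
    (by rw [Nat.two_mul_div_two_of_even (even_pred_mul_pred_of_coprime h)]
        exact TorusKnotMilnor.finrank_singularHomology_one_fibre _ _)

/-- `T(p,q)` bounds a slice surface of genus `(p-1)(q-1)/2` (push the Milnor fibre into `B⁴`,
`Knot.HasSeifertSurfaceOfGenus.hasSliceSurfaceOfGenus_holds`). [cite: KronheimerMrowka1993, p. 775] -/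
theorem hasSliceSurfaceOfGenus_torusKnot (hp : 2 ≤ p) (hq : 2 ≤ q) (h : p.Coprime q) :
    (torusKnot p q hp hq h).HasSliceSurfaceOfGenus ((p - 1) * (q - 1) / 2) :=
  Knot.HasSeifertSurfaceOfGenus.hasSliceSurfaceOfGenus_holds (hasSeifertSurfaceOfGenus_torusKnot hp hq h)

/-- **`g(T(p,q)) ≤ (p-1)(q-1)/2`** for the Seifert genus. [cite: Milnor1968, §10 (PDF p. 46)] -/
theorem genus_torusKnot_le (hp : 2 ≤ p) (hq : 2 ≤ q) (h : p.Coprime q) :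
    (torusKnot p q hp hq h).genus ≤ (p - 1) * (q - 1) / 2 :=
  Knot.genus_le_of_hasSeifertSurfaceOfGenus (hasSeifertSurfaceOfGenus_torusKnot hp hq h)

/-- **`g₄(T(p,q)) ≤ (p-1)(q-1)/2`**: the upper bound of the Milnor conjecture, unconditionally.
[cite: KronheimerMrowka1993, Cor. 1.3 and p. 775] -/
theorem sliceGenus_torusKnot_le (hp : 2 ≤ p) (hq : 2 ≤ q) (h : p.Coprime q) :
    (torusKnot p q hp hq h).sliceGenus ≤ (p - 1) * (q - 1) / 2 :=
  Knot.sliceGenus_le_of_hasSliceSurfaceOfGenus (hasSliceSurfaceOfGenus_torusKnot hp hq h)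

/-- **The Milnor conjecture from Rasmussen's two theorems.** The named fact
`sliceGenus_torusKnot` (`g₄(T(p,q)) = (p-1)(q-1)/2`) follows from exactly the two undischarged
named facts of `Rasmussen.lean`: `abs_le_two_mul_sliceGenus` (`|s(K)| ≤ 2g₄(K)`, Rasmussen 2010,
Thm. 1) and `hasRasmussenInvariant_torusKnot` (`s(T(p,q)) = (p-1)(q-1)`, Thm. 4) — the upper
bound being the Milnor fibre (`hasSeifertSurfaceOfGenus_torusKnot`). Rasmussen (2010), §1
Cor. 1, §5.2. [cite: Rasmussen2010, §1 Cor. 1 and §5.2] -/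
theorem sliceGenus_torusKnot_of_rasmussen (h₁ : abs_le_two_mul_sliceGenus)
    (h₂ : hasRasmussenInvariant_torusKnot) : sliceGenus_torusKnot :=
  sliceGenus_torusKnot_of_hasSeifertSurfaceOfGenus h₁ h₂ fun _ _ hp hq h =>
    hasSeifertSurfaceOfGenus_torusKnot hp hq h

/-- **The Milnor conjecture from Rasmussen's Theorem 1 alone.** With the value
`s(T(p,q)) = (p-1)(q-1)` discharged in the tree (`hasRasmussenInvariant_torusKnot_holds`,
`RasmussenProofs.lean`) and the Milnor fibre supplying the upper bound, the named fact
`sliceGenus_torusKnot` (`g₄(T(p,q)) = (p-1)(q-1)/2`) follows from the single named fact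
`abs_le_two_mul_sliceGenus` (`|s(K)| ≤ 2g₄(K)`, Rasmussen 2010, Thm. 1).
[cite: Rasmussen2010, §1 Cor. 1] -/
theorem sliceGenus_torusKnot_of_abs_le_two_mul_sliceGenus (h₁ : abs_le_two_mul_sliceGenus) :
    sliceGenus_torusKnot :=
  sliceGenus_torusKnot_of_rasmussen h₁ hasRasmussenInvariant_torusKnot_holds

/-! ### Only the upper half `s(K) ≤ 2 g₄(K)` of Rasmussen's Theorem 1 is needed -/

/-- **The Milnor conjecture from the bare lower bound.** Since `T(p,q)` bounds a slice surface of
genus `(p-1)(q-1)/2` (the Milnor fibre, `hasSliceSurfaceOfGenus_torusKnot`), the named fact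
`sliceGenus_torusKnot` is equivalent to — and here derived from — the statement that every slice
surface of `T(p,q)` has genus `g` with `(p-1)(q-1) ≤ 2g`; this is the form in which gauge theory
delivers it (Kronheimer–Mrowka (1993), Cor. 1.3: the adjunction inequality for the closed surface
obtained by capping a slice surface with the complement of `B⁴` in the algebraic curve).
The slice genus is attained at a slice surface (`Nat.sInf_mem`), to which the hypothesis applies.
[cite: KronheimerMrowka1993, Cor. 1.3 and p. 775] -/
theorem sliceGenus_torusKnot_of_lowerBound
    (hlow : ∀ (p q : ℕ) (hp : 2 ≤ p) (hq : 2 ≤ q) (h : p.Coprime q) (g : ℕ),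
      (torusKnot p q hp hq h).HasSliceSurfaceOfGenus g → (p - 1) * (q - 1) ≤ 2 * g) :
    sliceGenus_torusKnot := by
  intro p q hp hq h
  have hle : (torusKnot p q hp hq h).sliceGenus ≤ (p - 1) * (q - 1) / 2 :=
    sliceGenus_torusKnot_le hp hq h
  have hmem : (torusKnot p q hp hq h).HasSliceSurfaceOfGenus (torusKnot p q hp hq h).sliceGenus :=
    Nat.sInf_mem (s := {g | (torusKnot p q hp hq h).HasSliceSurfaceOfGenus g})
      ⟨_, hasSliceSurfaceOfGenus_torusKnot hp hq h⟩
  have hge : (p - 1) * (q - 1) ≤ 2 * (torusKnot p q hp hq h).sliceGenus := hlow p q hp hq h _ hmem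
  generalize (p - 1) * (q - 1) = N at hle hge ⊢
  omega

/-- **Rasmussen's sandwich, one-sided** (compare `Knot.sliceGenus_eq_of_hasRasmussenInvariant`,
`RasmussenTorusKnotProofs.lean`). Granted only the upper half `s(K) ≤ 2 g₄(K)` of Rasmussen's
Theorem 1 for all knots (hypothesis `hup` — the half obtained in §4.4 from the cobordism maps
`φ_S : K → U` alone, *"so `s_max(K) ≤ 2g + 1` and `s(K) ≤ 2g`"*, before the mirror argument), a
knot `K` with a Rasmussen invariant `s ≥ 2g` which bounds a slice surface of genus `g` has
`g₄(K) = g`: `2g ≤ s ≤ 2 g₄(K) ≤ 2g`. Rasmussen (2010), §4.4 (p. 10) and §5.2.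
[cite: Rasmussen2010, §5.2] -/
theorem Knot.sliceGenus_eq_of_le_two_mul_sliceGenus
    (hup : ∀ {K : Knot} {s : ℤ}, K.HasRasmussenInvariant s → s ≤ 2 * (K.sliceGenus : ℤ))
    {K : Knot} {s : ℤ} {g : ℕ} (hs : K.HasRasmussenInvariant s) (hg : 2 * (g : ℤ) ≤ s)
    (hS : K.HasSliceSurfaceOfGenus g) : K.sliceGenus = g := by
  refine le_antisymm (Knot.sliceGenus_le_of_hasSliceSurfaceOfGenus hS) ?_
  have h : 2 * (g : ℤ) ≤ 2 * (K.sliceGenus : ℤ) := hg.trans (hup hs)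
  exact_mod_cast Int.le_of_mul_le_mul_left h two_pos

/-- **The Milnor conjecture from the upper half of Rasmussen's Theorem 1.** Since
`s(T(p,q)) = (p-1)(q-1) ≥ 0` (`hasRasmussenInvariant_torusKnot_holds`, Rasmussen (2010), Thm. 4)
and `g₄(T(p,q)) ≤ (p-1)(q-1)/2` (the Milnor fibre, `hasSliceSurfaceOfGenus_torusKnot`), the
named fact `sliceGenus_torusKnot` follows from the one-sided bound `s(K) ≤ 2 g₄(K)` for all knots
alone — the half of Theorem 1 that Rasmussen proves first, from the maps `φ_S` of cobordisms
`K → U` (§4.4, p. 10: *"It follows that `s(x) ≤ 2g + 1`, so `s_max(K) ≤ 2g + 1` and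
`s(K) ≤ 2g`"*), with no appeal to the mirror image `s(K̄) = -s(K)`. Rasmussen (2010), §1 Cor. 1,
§4.4, §5.2. [cite: Rasmussen2010, §1 Cor. 1 and §4.4] -/
theorem sliceGenus_torusKnot_of_le_two_mul_sliceGenus
    (hup : ∀ {K : Knot} {s : ℤ}, K.HasRasmussenInvariant s → s ≤ 2 * (K.sliceGenus : ℤ)) :
    sliceGenus_torusKnot := by
  intro p q hp hq h
  refine Knot.sliceGenus_eq_of_le_two_mul_sliceGenus hup
    (hasRasmussenInvariant_torusKnot_holds p q hp hq h) (le_of_eq ?_)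
    (hasSliceSurfaceOfGenus_torusKnot hp hq h)
  have hN : 2 * ((p - 1) * (q - 1) / 2) = (p - 1) * (q - 1) :=
    Nat.two_mul_div_two_of_even (even_pred_mul_pred_of_coprime h)
  have e₁ : ((p - 1 : ℕ) : ℤ) = (p : ℤ) - 1 := by omega
  have e₂ : ((q - 1 : ℕ) : ℤ) = (q : ℤ) - 1 := by omega
  rw [← e₁, ← e₂, ← Nat.cast_mul]
  exact_mod_cast hN

/-- **The Milnor conjecture from the upper half of Theorem 1, read on diagrams.** If every regular
projection `P` of every knot bounding a slice surface of genus `g` reads a Gauss diagram with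
`s(P.diagram) ≤ 2g` (the diagrammatic core of the upper half of Rasmussen's Theorem 1,
`le_two_mul_sliceGenus_of_diagram` of `RasmussenSliceGenusProofs.lean`), then
`g₄(T(p,q)) = (p-1)(q-1)/2`. Rasmussen (2010), Thm. 1, §4.4 and §1 Cor. 1.
[cite: Rasmussen2010, §1 Cor. 1 and §4.4] -/
theorem sliceGenus_torusKnot_of_diagram
    (h : ∀ {K : Knot} (P : K.RegularProjection) {g : ℕ}, K.HasSliceSurfaceOfGenus g →
      P.diagram.rasmussenInvariant ≤ 2 * (g : ℤ)) :
    sliceGenus_torusKnot :=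
  sliceGenus_torusKnot_of_le_two_mul_sliceGenus fun hK => le_two_mul_sliceGenus_of_diagram h hK

/-- **The Milnor conjecture from the cobordism maps `φ_S : K → U` on Lee homology.** If every knot
`K` in regular position `P` bounding a slice surface of genus `g` comes with a map of degree-zero
Lee cycles `φ : Z⁰(P.diagram) → Z⁰(U)`, `U = GaussDiagram.empty` the crossingless diagram of the
round unknot, killing no nonzero Lee homology class and lowering the filtration degree `qMin` by
at most `2g` — Rasmussen's `φ_S` for the connected genus-`g` cobordism `S : K → U` cut out of the
slice surface, *"a filtered map of degree `χ(S)`"* `= -2g` (§4.2) and an isomorphism (Cor. 4.2) —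
then `g₄(T(p,q)) = (p-1)(q-1)/2`: the hypothesis is exactly that of
`le_two_mul_sliceGenus_of_filtered` (`RasmussenSliceGenusProofs.lean`), which gives the upper
half `s(K) ≤ 2 g₄(K)` of Theorem 1, and `sliceGenus_torusKnot_of_le_two_mul_sliceGenus`
concludes. So the Milnor conjecture needs the maps in the direction `K → U` only, and neither the
reversed cobordism nor the mirror formula. Rasmussen (2010), Thm. 1, §4.2, Cor. 4.2, §4.4, §1
Cor. 1. [cite: Rasmussen2010, §1 Cor. 1 and §4.4] -/
theorem sliceGenus_torusKnot_of_filtered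
    (h : ∀ {K : Knot} (P : K.RegularProjection) {g : ℕ}, K.HasSliceSurfaceOfGenus g →
      ∃ φ : P.diagram.leeCycles → GaussDiagram.empty.leeCycles,
        (∀ z : P.diagram.leeCycles,
          (Submodule.Quotient.mk (φ z) : GaussDiagram.empty.LeeHomologyZero) = 0 →
          (Submodule.Quotient.mk z : P.diagram.LeeHomologyZero) = 0) ∧
        (∀ z : P.diagram.leeCycles,
          GaussDiagram.qMin z.1 ≤ GaussDiagram.qMin (φ z).1 + (2 * g : ℕ))) :
    sliceGenus_torusKnot :=
  sliceGenus_torusKnot_of_le_two_mul_sliceGenus fun hK => le_two_mul_sliceGenus_of_filtered h hK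

end TorusKnot

end Literature.Topology.FourManifolds
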